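import Summits.ABC.IUTFork.Repair.RHQ3LTailUniformRow15
import Summits.ABC.IUTFork.Repair.RHQ3LTailHullSharp
import HarnessLib

/-!
# D-0079 RESCUE sub-cell R-H, ROUND 2 Q3 — row 4 «hull-threshold-exact» (closed-form column, deep-member radii): «NOT UNIFORMLY» IN KERNEL,
# UNCONDITIONALLY (seat abc-iut-rh2-q3-typ-1 g4)

PROOF-ONLY file (D-0012; 0 definitions, 0 `Prop` facts, no instance, no notation). Rung LADDER-ABC:A2.RESCUE.H, director charge (10) «per kept row
… prove or refute». Row 4's per-CURVE l-tail reading is PROVED (`RH.Q3LTailHullSharp.lTailSigma4Sharp_holds`, p480748, this lineage g2: `∀ (F, E) ∃ l₀(E)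
∀ l ≥ l₀ ∀ Def-3.1 data: an outer-radius function `rout`, untied and ATTAINED by unit logarithms on the bad places, with abc-iut-rh-typ-4's
`RH.HullThresholdExact.HStarClosedForm (pilotDataOfK D K) rin rout` for every `rin ≥ 1`»). THIS FILE refutes its UNIFORM reading (`∃ l₀` before
`∀ (F, E)`) with NO hypothesis: **`not_exists_uniform_l0_hStarClosedForm`**, and records both halves (`perCurve_and_not_uniform`). Even the Galois-guarded
uniform reading is refuted (`not_exists_uniform_l0_hStarClosedForm_isGalois`, the witness data having `K/ℚ` Galois).

MECHANISM (same tame place as row 15, companion `RHQ3LTailUniformRow15`). The closed-form cell is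
`HullCell e m j r_in r_out := e·⌊(j²m − j(e−1) − (j+1)r_in)/e⌋ ≤ m − (j+1)·r_out`, MONOTONE in `r_in`, ANTITONE in `r_out`
(`hullCell_mono_rin` / `hullCell_anti_rout`). A radius `r_out(w)` ATTAINED by a member `z ∈ log_p 𝒪_w^×` (`p^{−r_out/e_w} ≤ ‖z‖`) at a TAME place
(`p > 2`, `e_w ≤ p − 2`, so `log_p 𝒪_w^× = 𝔪_w`: [IUTchIV] Prop. 1.2 (i) equality clause) has `r_out(w) ≥ 1` (`Q3LTailSigma15.Uniform.exponent_le_placeOf`);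
so the cell at `(r_in, r_out) = (1, r_out(w))` implies the cell at `(1, 1)` = abc-iut-w5-d180's exact tame dichotomy `e·⌊(j²m−1)/e⌋ + 1 − j(e−1) ≤ m`
(`hullCell_one_one_iff`), which FAILS once `(j−1)·m ≥ e` (§1). At the genuine `K`-level datum `2l·m = e(w|v)·ord_v(q_v)`, `e_w = e(w|v)·e(v|p)`, so the
top label `j = l⋆` is OUT as soon as `4·l·e(v|p) ≤ (l−3)·ord_v(q_v)` (§2 `ramIdx_le_pred_lstar_mul`, `not_hStarClosedForm_one_of_heavy_tame`); the witness
family and its Galois datum are this lineage's (g3/g4: prime `l ≡ 3 (4)`, `l > max(l₀,160)`; prime `r ∈ (30l+1, 60l+2]`; `λ_r = r⁸/(r⁸+1)`; pole `h = 16`).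

READING (numbers, no side). «Q3 (row 4, closed-form column): YES PER CURVE, NOT UNIFORMLY» — both halves kernel theorems, no existence input. With
`RHQ3LTailUniformRow15` (row 15), p491961 (row 3) and p489180/p493238 (row 8) every THRESHOLD/DATUM row of the lineage's charge whose per-curve target
was proved now also has its uniform reading refuted in kernel; row 5 is vacuous in the tail (p470687) and row 16 is `l`-free (p474064). Nothing here
asserts abc or takes a side on [IUTchIII] Cor. 3.12 or on any author; `HStarClosedForm`/`HullCell` (abc-iut-rh-typ-4 p458452) are row 4's HYPOTHESIS
column about OUR typed objects; the Θ-data are the tree's interface inhabitants as in every R-W refutation of record; refuted-as-typed ≠ refuted-in-print.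
[cite: Mochizuki2012, IUTchI Def. 3.1 (b)(c) pp. 61–62, Ex. 3.2 (iv) p. 71; IUTchIV Prop. 1.2 (i) p. 10, Prop. 1.4 (ii) p. 13, Cor. 2.2 (ii) proof
(P2)(P5)(P6)(P7) pp. 45–46] [cite: NeukirchANT1999, Ch. II Prop. (5.5)] [claim: Mochizuki2012, status: disputed] for every IUT locution.
-/

noncomputable section

open Set Function NumberField IsDedekindDomain Metric

namespace Summit.ABC.IUTFork.Repair.RH.Q3LTailHullSharp

open Literature.IUT.LogThetaLattice Literature.IUT.LogVolume Literature.IUT.HodgeTheaters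
open Literature.IUT.LogVolume.ThetaData Literature.IUT.LogVolume.Cor22
open Summit.ABC.IUTFork.Thm311 Summit.ABC.IUTFork.Thm311.Real Summit.ABC.IUTFork.Cor312Prov Summit.ABC.IUTFork.Repair.RHHeightClass
  Summit.ABC.IUTFork.Repair.RH.HullThresholdExact
open Literature.NumberTheory.NumberFields Literature.NumberTheory.GaloisRepresentations.Ultrametric
  Literature.NumberTheory.DiophantineGeometry Literature.NumberTheory.DiophantineGeometry.GenEll
  Literature.NumberTheory.DiophantineGeometry.UniformABCConjecture Rat.HeightOneSpectrum Summit.ABC.ABC.Theorems Summit.ABC.IUTFork.Conditional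
  Summit.ABC.IUTFork.Repair.RH.Q3LTailSigma8.UniformWitness Summit.ABC.IUTFork.Repair.RH.Q3LTailSigma15.Uniform

namespace Uniform

/-! ## §1. The exact cell at `(1, 1)` — hence at `(1, r_out)` for any `r_out ≥ 1` — FAILS once `(j−1)·m ≥ e` -/

/-- **The tame exact cell fails at a heavy label.** `e ≥ 1`, `j ≥ 1`, `e ≤ (j−1)·m` ⟹ `¬ HullCell e m j 1 1`: by `hullCell_one_one_iff` the cell is
`e·⌊(j²m−1)/e⌋ + 1 − j(e−1) ≤ m`, and `e·⌊x/e⌋ ≥ x − e + 1` turns it into `(j²−1)·m ≤ (j+1)(e−1)`, i.e. `(j−1)·m ≤ e − 1`. [folklore] -/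
theorem not_hullCell_one_one_of_heavy {e m j : ℤ} (he : 1 ≤ e) (hj : 1 ≤ j) (hheavy : e ≤ (j - 1) * m) : ¬ HullCell e m j 1 1 := by
  rw [hullCell_one_one_iff (by omega) m j]
  intro hc
  have h1 := Int.mul_ediv_add_emod (j ^ 2 * m - 1) e
  have h2 := Int.emod_lt_of_pos (j ^ 2 * m - 1) (by omega : (0 : ℤ) < e)
  -- `(j+1)·((j−1)·m) ≤ (j+1)·(e−1)`
  have h3 : (j + 1) * ((j - 1) * m) ≤ (j + 1) * (e - 1) := by nlinarith
  have h4 : (j - 1) * m ≤ e - 1 := le_of_mul_le_mul_left h3 (by omega)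
  omega

/-- **… hence at every attained outer radius**: `r_out ≥ 1` ⟹ `¬ HullCell e m j 1 r_out` (antitone in `r_out`, `hullCell_anti_rout`). [folklore] -/
theorem not_hullCell_one_of_heavy {e m j rout : ℤ} (he : 1 ≤ e) (hj : 1 ≤ j) (hheavy : e ≤ (j - 1) * m) (hrout : 1 ≤ rout) :
    ¬ HullCell e m j 1 rout :=
  fun hc => not_hullCell_one_one_of_heavy he hj hheavy (hullCell_anti_rout (by omega) hrout hc)

/-! ## §2. At the genuine `K`-level datum: a TAME bad place with `4·l·e(v|p) ≤ (l−3)·ord_v(q_v)` defeats the column for EVERY attained `r_out` -/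

section Genuine

variable {F K Fbar : Type} [Field F] [NumberField F] [Field K] [NumberField K] [Algebra F K] [Field Fbar]
  [Algebra F Fbar] [Algebra K Fbar] {E : WeierstrassCurve F} [E.IsElliptic] {l : ℕ} {Pb : BadPlacePredicates K}
  (D : InitialThetaData F K Fbar E l Pb)

/-- **THE HEAVY INEQUALITY IN `𝔪_w`-UNITS.** At a bad place `w = placeOf x₀ ∣ p` of `pilotDataOfK D K` with integer pilot order `P_q(w) = P` and
`4·l·e(v|p) ≤ (l−3)·ord_v(q_v)` (`v` the place of `F` under `w`): `e_w ≤ (l⋆ − 1)·P`, `l⋆ = (l−1)/2` — since `2l·P = e(w|v)·ord_v(q_v)` ([IUTchI] Ex. 3.2 (iv),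
`exists_nat_qPilot_pilotDataOfK`), `e_w = e(v|p)·e(w|v)` and `2(l⋆−1) = l − 3` (`l` an odd prime). [cite: Mochizuki2012, IUTchI Ex. 3.2 (iv) p. 71]
[claim: Mochizuki2012, status: disputed] -/
theorem ramIdx_le_pred_lstar_mul (pp : Nat.Primes) (x₀ : (thetaIndex (pilotDataOfK D K)).Fibre (.inr pp))
    (hx₀ : haveI : Fact (pp : ℕ).Prime := ⟨pp.2⟩; placeOf (pilotDataOfK D K) pp.1 x₀ ∈ (pilotDataOfK D K).S)
    (hheavy : haveI : Fact (pp : ℕ).Prime := ⟨pp.2⟩;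
      4 * l * ramIdx F (finBelow F K (placeOf (pilotDataOfK D K) pp.1 x₀)) ≤
        (l - 3) * qParamOrd E (finBelow F K (placeOf (pilotDataOfK D K) pp.1 x₀)))
    {P : ℕ} (hP : haveI : Fact (pp : ℕ).Prime := ⟨pp.2⟩; (pilotDataOfK D K).qPilot (placeOf (pilotDataOfK D K) pp.1 x₀) = P) :
    haveI : Fact (pp : ℕ).Prime := ⟨pp.2⟩
    ramIdx K (placeOf (pilotDataOfK D K) pp.1 x₀) ≤ ((l - 1) / 2 - 1) * P := by
  haveI : Fact (pp : ℕ).Prime := ⟨pp.2⟩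
  set w := placeOf (pilotDataOfK D K) pp.1 x₀ with hwdef
  set v := finBelow F K w with hvdef
  have h5 : 5 ≤ l := D.five_le_l
  have hodd : ¬ 2 ∣ l := fun h => by
    have := (Nat.prime_dvd_prime_iff_eq Nat.prime_two D.l_prime).1 h
    omega
  obtain ⟨P', hP', -, h2lP⟩ := exists_nat_qPilot_pilotDataOfK D hx₀
  have hPP : P' = P := by
    have h := hP'.symm.trans hP
    exact_mod_cast h
  subst hPP
  have hew : ramIdx K w = ramIdx F v * Ideal.ramificationIdx' v.asIdeal w.asIdeal := by
    rw [ramIdx_eq, ThetaData.absRamificationIdx_eq_ramIdx_mul (F := F) w]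
    rfl
  have h2i : 2 * ((l - 1) / 2 - 1) = l - 3 := by omega
  have hA : 2 * (2 * l * ramIdx F v) ≤ 2 * (((l - 1) / 2 - 1) * qParamOrd E v) := by
    calc 2 * (2 * l * ramIdx F v) = 4 * l * ramIdx F v := by ring
      _ ≤ (l - 3) * qParamOrd E v := hheavy
      _ = 2 * (((l - 1) / 2 - 1) * qParamOrd E v) := by rw [← h2i]; ring
  have hB : 2 * l * ramIdx F v ≤ ((l - 1) / 2 - 1) * qParamOrd E v := Nat.le_of_mul_le_mul_left hA (by norm_num)
  have hC : 2 * l * ramIdx K w ≤ 2 * l * (((l - 1) / 2 - 1) * P') := by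
    calc 2 * l * ramIdx K w = (2 * l * ramIdx F v) * Ideal.ramificationIdx' v.asIdeal w.asIdeal := by rw [hew]; ring
      _ ≤ (((l - 1) / 2 - 1) * qParamOrd E v) * Ideal.ramificationIdx' v.asIdeal w.asIdeal := Nat.mul_le_mul_right _ hB
      _ = ((l - 1) / 2 - 1) * (Ideal.ramificationIdx' v.asIdeal w.asIdeal * qParamOrd E v) := by ring
      _ = ((l - 1) / 2 - 1) * (2 * l * P') := by rw [← h2lP]
      _ = 2 * l * (((l - 1) / 2 - 1) * P') := by ring
  exact Nat.le_of_mul_le_mul_left hC (by omega)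

/-- **OUT OF THE ROW-4 COLUMN AT A HEAVY TAME PLACE, WHATEVER THE ATTAINED RADIUS.** `x₀ ∣ p` a bad place of `pilotDataOfK D K` with `p > 2`,
`e_{x₀} ≤ p − 2` and `4·l·e(v|p) ≤ (l−3)·ord_v(q_v)`: for EVERY outer-radius function `rout` whose value at `x₀` is ATTAINED by a unit logarithm
(`∃ z ∈ log_p 𝒪^×`, `p^{−rout/e} ≤ ‖z‖`, hence `rout(x₀) ≥ 1` at the tame place), the closed-form column FAILS at inner radius `rin ≡ 1`:
`¬ HStarClosedForm (pilotDataOfK D K) 1 rout` — at the cell `(x₀, j = l⋆)`, §1 with `ramIdx_le_pred_lstar_mul`. [cite: Mochizuki2012, IUTchI Def. 3.1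
(b)(c) pp. 61–62, Ex. 3.2 (iv) p. 71; IUTchIV Prop. 1.2 (i) p. 10] [cite: NeukirchANT1999, Ch. II Prop. (5.5)] [claim: Mochizuki2012, status: disputed] -/
theorem not_hStarClosedForm_one_of_heavy_tame (pp : Nat.Primes) (hp2 : 2 < (pp : ℕ))
    (x₀ : (thetaIndex (pilotDataOfK D K)).Fibre (.inr pp))
    (hx₀ : haveI : Fact (pp : ℕ).Prime := ⟨pp.2⟩; placeOf (pilotDataOfK D K) pp.1 x₀ ∈ (pilotDataOfK D K).S)
    (htame : haveI : Fact (pp : ℕ).Prime := ⟨pp.2⟩; ramIdx K (placeOf (pilotDataOfK D K) pp.1 x₀) ≤ (pp : ℕ) - 2)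
    (hheavy : haveI : Fact (pp : ℕ).Prime := ⟨pp.2⟩;
      4 * l * ramIdx F (finBelow F K (placeOf (pilotDataOfK D K) pp.1 x₀)) ≤
        (l - 3) * qParamOrd E (finBelow F K (placeOf (pilotDataOfK D K) pp.1 x₀)))
    (rout : ∀ pp : Nat.Primes, (thetaIndex (pilotDataOfK D K)).Fibre (.inr pp) → ℤ)
    (hrout : haveI : Fact (pp : ℕ).Prime := ⟨pp.2⟩;
      ∃ z ∈ (logUnits (kOf (pilotDataOfK D K) pp.1 x₀) : Set (kOf (pilotDataOfK D K) pp.1 x₀)),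
        ((pp : ℕ) : ℝ) ^ (-(rout pp x₀ : ℝ) / (ramIdx K (placeOf (pilotDataOfK D K) pp.1 x₀) : ℝ)) ≤ ‖z‖) :
    ¬ HStarClosedForm (pilotDataOfK D K) (fun _ _ => 1) rout := by
  haveI : Fact (pp : ℕ).Prime := ⟨pp.2⟩
  intro hH
  set w := placeOf (pilotDataOfK D K) pp.1 x₀ with hwdef
  -- the top label `i = l⋆ − 1`
  have hls : (pilotDataOfK D K).lstar = (l - 1) / 2 := by
    unfold PilotData.lstar
    rw [pilotDataOfK_l]
  have h5 : 5 ≤ l := D.five_le_l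
  set i : Fin (pilotDataOfK D K).lstar := ⟨(l - 1) / 2 - 1, by rw [hls]; omega⟩ with hidef
  -- the integer pilot order and the cell at `(x₀, i)`
  obtain ⟨P, hP, -, -⟩ := exists_nat_qPilot_pilotDataOfK D hx₀
  have hc := hH pp i x₀ hx₀ P hP
  dsimp only at hc
  rw [← ramIdx_eq K w] at hc
  -- `rout(x₀) ≥ 1` at the tame place
  have he0 : (0 : ℝ) < (ramIdx K w : ℝ) := by exact_mod_cast Nat.one_le_iff_ne_zero.2 (ramIdx_ne_zero K w)
  have hexp : -(rout pp x₀ : ℝ) / (ramIdx K w : ℝ) ≤ -(1 / (ramIdx K w : ℝ)) :=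
    exponent_le_placeOf (pilotDataOfK D K) pp.1 hp2 x₀ htame hrout
  have hr1 : 1 ≤ rout pp x₀ := by
    by_contra hlt
    rw [not_le] at hlt
    have hle : (rout pp x₀ : ℝ) ≤ 0 := by exact_mod_cast (by omega : rout pp x₀ ≤ 0)
    have h0 : (0 : ℝ) ≤ -(rout pp x₀ : ℝ) / (ramIdx K w : ℝ) := div_nonneg (by linarith) he0.le
    have h1 : (0 : ℝ) < 1 / (ramIdx K w : ℝ) := by positivity
    linarith
  -- the heavy inequality `e_w ≤ (l⋆−1)·P = ((i+1) − 1)·P` and §1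
  have hheavy' : (ramIdx K w : ℤ) ≤ ((((i : ℕ) : ℤ) + 1) - 1) * (P : ℤ) := by
    have h := ramIdx_le_pred_lstar_mul D pp x₀ hx₀ hheavy hP
    have hi : ((i : ℕ) : ℤ) = (((l - 1) / 2 - 1 : ℕ) : ℤ) := rfl
    rw [add_sub_cancel_right, hi]
    exact_mod_cast h
  exact not_hullCell_one_of_heavy (by exact_mod_cast Nat.one_le_iff_ne_zero.2 (ramIdx_ne_zero K w)) (by omega) hheavy' hr1 hc

end Genuine

/-! ## §3. Rational points with a large tame pole prime, and «NOT UNIFORMLY» for row 4 -/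

section Out

/-- **OUT OF THE ROW-4 COLUMN AT A RATIONAL POINT WITH A LARGE TAME POLE PRIME.** `λ ∈ ℚ`, `T` a genuine Θ-volume datum at `(ratPoint λ, l)` (`l` prime),
`p ∉ {2, 3, 5, l}` prime with `30·l + 2 ≤ p` at which `j(λ)` has a pole of exact order `h ≥ 1`, `4·l ≤ (l−3)·h`: for EVERY `rout` attained by unit logarithms on
the bad places, `¬ HStarClosedForm (pilotDataOfK T.D T.K) 1 rout` (the bad place over `p` of `UniformWitness.exists_heavy_place_ratPoint_of_pole` is tame,
`e_{x₀} ≤ 30·l ≤ p − 2`, with `ord_v(q_v) = e(v|p)·h`; §2). [cite: Mochizuki2012, IUTchI Def. 3.1 (b)(c) pp. 61–62; IUTchIV Prop. 1.2 (i) p. 10, Thm. 1.10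
Steps (ii)–(iii) pp. 24–26] [cite: SerreLocalFields1979, Ch. IV §2 Cor. 1 of Prop. 7] [claim: Mochizuki2012, status: disputed] -/
theorem not_hStarClosedForm_ratPoint_of_pole {q : ℚ} {l : ℕ} (T : ThetaVolumeDatumAt (ratPoint q) l) (hP : ratPoint q ∈ UP) (hl : l.Prime)
    (pp : Nat.Primes) (hp2 : (pp : ℕ) ≠ 2) (hp3 : (pp : ℕ) ≠ 3) (hp5 : (pp : ℕ) ≠ 5) (hpl : (pp : ℕ) ≠ l) (h30 : 30 * l + 2 ≤ (pp : ℕ))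
    {h : ℕ} (hh : 0 < h) (hord : ∀ u : HeightOneSpectrum (𝓞 ℚ), natGenerator u = (pp : ℕ) → ord ℚ u (jInv q) = -(h : ℤ))
    (hineq : 4 * l ≤ (l - 3) * h) :
    letI := T.instFieldF; letI := T.instNumberFieldF; letI := T.instAlgebraF; letI := T.instFieldK
    letI := T.instNumberFieldK; letI := T.instAlgebraK; letI := T.instFieldFbar; letI := T.instAlgebraFbar
    letI := T.instAlgebraKFbar; letI := T.instIsElliptic
    ∀ rout : ∀ pp : Nat.Primes, (thetaIndex (pilotDataOfK T.D T.K)).Fibre (.inr pp) → ℤ,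
      (∀ (pp : Nat.Primes) (w : (thetaIndex (pilotDataOfK T.D T.K)).Fibre (.inr pp)),
        haveI : Fact (pp : ℕ).Prime := ⟨pp.2⟩
        placeOf (pilotDataOfK T.D T.K) pp.1 w ∈ (pilotDataOfK T.D T.K).S →
          ∃ z ∈ (logUnits (kOf (pilotDataOfK T.D T.K) pp.1 w) : Set (kOf (pilotDataOfK T.D T.K) pp.1 w)),
            ((pp : ℕ) : ℝ) ^ (-(rout pp w : ℝ) / (ramIdx T.K (placeOf (pilotDataOfK T.D T.K) pp.1 w) : ℝ)) ≤ ‖z‖) →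
      ¬ HStarClosedForm (pilotDataOfK T.D T.K) (fun _ _ => 1) rout := by
  letI := T.instFieldF; letI := T.instNumberFieldF; letI := T.instAlgebraF; letI := T.instFieldK
  letI := T.instNumberFieldK; letI := T.instAlgebraK; letI := T.instFieldFbar; letI := T.instAlgebraFbar
  letI := T.instAlgebraKFbar; letI := T.instIsElliptic
  haveI : Fact (pp : ℕ).Prime := ⟨pp.2⟩
  intro rout hrout
  obtain ⟨x₀, hx₀S, hB, hq⟩ := exists_heavy_place_ratPoint_of_pole T hP hl pp hp2 hp3 hp5 hpl hh hord
  refine not_hStarClosedForm_one_of_heavy_tame T.D pp (by omega) x₀ hx₀S (by omega) ?_ rout (hrout pp x₀ hx₀S)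
  rw [hq]
  set e := ramIdx T.F (finBelow T.F T.K (placeOf (pilotDataOfK T.D T.K) pp.1 x₀)) with hedef
  calc 4 * l * e ≤ ((l - 3) * h) * e := Nat.mul_le_mul_right _ hineq
    _ = (l - 3) * (e * h) := by ring

end Out

/-- **Q3 (row 4, closed-form column), UNIFORM READING OVER GALOIS DATA — REFUTED UNCONDITIONALLY.** There is NO `l₀` such that every [IUTchI] Def. 3.1
datum of every level `l ≥ l₀` over every curve, with `K/ℚ` Galois, admits an outer-radius function `rout`, untied (`StrictMinPow`) and attained by unit
logarithms on the bad places, with `HStarClosedForm (pilotDataOfK D K) rin rout` for every `rin ≥ 1` on the bad places. Witness at a given `l₀`: prime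
`l ≡ 3 (mod 4)`, `l > max(l₀, 160)`; prime `r ∈ (30l+1, 60l+2]`; `λ_r = r⁸/(r⁸+1)`; the Galois datum of `UniformWitness.exists_thetaVolumeDatumAt_isGalois`;
`not_hStarClosedForm_ratPoint_of_pole` at `p = r`, `h = 16`, `rin ≡ 1`. (Only the ATTAINED half of the certificate is used; `StrictMinPow` is not needed for
the refutation.) No abc claim; no side on [IUTchIII] Cor. 3.12; `HStarClosedForm` = row 4's hypothesis column. [cite: Mochizuki2012, IUTchI Def. 3.1 (b)(c)
pp. 61–62, Ex. 3.2 (iv) p. 71; IUTchIV Prop. 1.2 (i) p. 10, Cor. 2.2 (ii) proof (P2)(P5)(P6)(P7) pp. 45–46] [cite: Mazur1978, §6 Prop. 6.3 (1) p. 153]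
[claim: Mochizuki2012, status: disputed] -/
theorem not_exists_uniform_l0_hStarClosedForm_isGalois :
    ¬ ∃ l₀ : ℕ, ∀ l : ℕ, l₀ ≤ l →
      ∀ (F : Type) [Field F] [NumberField F] (E : WeierstrassCurve F) [E.IsElliptic]
        (K Fbar : Type) [Field K] [NumberField K] [Algebra F K] [Field Fbar] [Algebra F Fbar] [Algebra K Fbar]
        (Pb : BadPlacePredicates K) (D : InitialThetaData F K Fbar E l Pb), IsGalois ℚ K →
        ∃ rout : ∀ pp : Nat.Primes, (thetaIndex (pilotDataOfK D K)).Fibre (.inr pp) → ℤ,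
          (∀ (pp : Nat.Primes) (w : (thetaIndex (pilotDataOfK D K)).Fibre (.inr pp)),
            haveI : Fact (pp : ℕ).Prime := ⟨pp.2⟩
            placeOf (pilotDataOfK D K) pp.1 w ∈ (pilotDataOfK D K).S →
              StrictMinPow pp (ramIdx K (placeOf (pilotDataOfK D K) pp.1 w)) (rout pp w) ∧
              ∃ z ∈ (logUnits (kOf (pilotDataOfK D K) pp.1 w) : Set (kOf (pilotDataOfK D K) pp.1 w)),
                ((pp : ℕ) : ℝ) ^ (-(rout pp w : ℝ) / (ramIdx K (placeOf (pilotDataOfK D K) pp.1 w) : ℝ)) ≤ ‖z‖) ∧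
          ∀ rin : ∀ pp : Nat.Primes, (thetaIndex (pilotDataOfK D K)).Fibre (.inr pp) → ℤ,
            (∀ (pp : Nat.Primes) (w : (thetaIndex (pilotDataOfK D K)).Fibre (.inr pp)),
              haveI : Fact (pp : ℕ).Prime := ⟨pp.2⟩
              placeOf (pilotDataOfK D K) pp.1 w ∈ (pilotDataOfK D K).S → 1 ≤ rin pp w) →
            HStarClosedForm (pilotDataOfK D K) rin rout := by
  rintro ⟨l₀, hall⟩
  obtain ⟨l, hlgt, hl, hmod⟩ := Nat.forall_exists_prime_gt_and_modEq (max l₀ 160) (q := 4) (a := 3) (by norm_num) (by norm_num)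
  have hl0 : l₀ ≤ l := le_trans (le_max_left _ _) hlgt.le
  have hl160 : 160 ≤ l := le_trans (le_max_right _ _) hlgt.le
  have hmod' : l % 4 = 3 := hmod
  obtain ⟨r, hr, h30, h60⟩ := Nat.exists_prime_lt_and_le_two_mul (30 * l + 1) (by omega)
  have hr2 : r ≠ 2 := by omega
  have hr5 : r ≠ 5 := by omega
  have hrl : r ≠ l := by omega
  have h3l : r ^ 8 + 1 < 3 ^ l := pow_eight_succ_lt_three_pow hl160 (by omega)
  obtain ⟨T, hGal⟩ := exists_thetaVolumeDatumAt_isGalois (mem_UP r hr.pos) hl (by omega) (admitsCore r hr (by omega))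
    (condP2 r hr hr2 hl (by omega) h3l) (condP5 r hr hr2 hl hrl) (condP6 r hr hr2 hr5 hl (by omega) hmod' hrl)
  letI := T.instFieldF; letI := T.instNumberFieldF; letI := T.instAlgebraF; letI := T.instFieldK
  letI := T.instNumberFieldK; letI := T.instAlgebraK; letI := T.instFieldFbar; letI := T.instAlgebraFbar
  letI := T.instAlgebraKFbar; letI := T.instIsElliptic
  obtain ⟨rout, hcert, hH⟩ := hall l hl0 T.F T.E T.K T.Fbar T.Pb T.D hGal
  exact not_hStarClosedForm_ratPoint_of_pole T (mem_UP r hr.pos) hl ⟨r, hr⟩ (by change r ≠ 2; omega) (by change r ≠ 3; omega)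
    (by change r ≠ 5; omega) (by change r ≠ l; omega) (by change 30 * l + 2 ≤ r; omega) (h := 16) (by norm_num)
    (fun u hu => by rw [ord_jInv_of_natGenerator_eq r hr hr2 u hu]; norm_num) (by omega) rout (fun pp w hw => (hcert pp w hw).2)
    (hH (fun _ _ => 1) fun _ _ _ => le_rfl)

/-- **… and OVER ALL DATA (the literal uniformisation of `LTailSigma4Sharp`, p480748)**: no `l₀` such that every Def-3.1 datum of level `l ≥ l₀` (no Galois
guard) admits such a certified `rout`. [claim: Mochizuki2012, status: disputed] -/
theorem not_exists_uniform_l0_hStarClosedForm :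
    ¬ ∃ l₀ : ℕ, ∀ l : ℕ, l₀ ≤ l →
      ∀ (F : Type) [Field F] [NumberField F] (E : WeierstrassCurve F) [E.IsElliptic]
        (K Fbar : Type) [Field K] [NumberField K] [Algebra F K] [Field Fbar] [Algebra F Fbar] [Algebra K Fbar]
        (Pb : BadPlacePredicates K) (D : InitialThetaData F K Fbar E l Pb),
        ∃ rout : ∀ pp : Nat.Primes, (thetaIndex (pilotDataOfK D K)).Fibre (.inr pp) → ℤ,
          (∀ (pp : Nat.Primes) (w : (thetaIndex (pilotDataOfK D K)).Fibre (.inr pp)),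
            haveI : Fact (pp : ℕ).Prime := ⟨pp.2⟩
            placeOf (pilotDataOfK D K) pp.1 w ∈ (pilotDataOfK D K).S →
              StrictMinPow pp (ramIdx K (placeOf (pilotDataOfK D K) pp.1 w)) (rout pp w) ∧
              ∃ z ∈ (logUnits (kOf (pilotDataOfK D K) pp.1 w) : Set (kOf (pilotDataOfK D K) pp.1 w)),
                ((pp : ℕ) : ℝ) ^ (-(rout pp w : ℝ) / (ramIdx K (placeOf (pilotDataOfK D K) pp.1 w) : ℝ)) ≤ ‖z‖) ∧
          ∀ rin : ∀ pp : Nat.Primes, (thetaIndex (pilotDataOfK D K)).Fibre (.inr pp) → ℤ,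
            (∀ (pp : Nat.Primes) (w : (thetaIndex (pilotDataOfK D K)).Fibre (.inr pp)),
              haveI : Fact (pp : ℕ).Prime := ⟨pp.2⟩
              placeOf (pilotDataOfK D K) pp.1 w ∈ (pilotDataOfK D K).S → 1 ≤ rin pp w) →
            HStarClosedForm (pilotDataOfK D K) rin rout := by
  rintro ⟨l₀, hall⟩
  exact not_exists_uniform_l0_hStarClosedForm_isGalois ⟨l₀, fun l hl F _ _ E _ K Fbar _ _ _ _ _ _ Pb D _ => hall l hl F E K Fbar Pb D⟩

/-- **ROW 4, BOTH HALVES SIDE BY SIDE: «YES PER CURVE, NOT UNIFORMLY»** — `lTailSigma4Sharp_holds` (p480748) for every curve, and no uniform `l₀`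
(`not_exists_uniform_l0_hStarClosedForm`). [claim: Mochizuki2012, status: disputed] -/
theorem perCurve_and_not_uniform :
    (∀ (F : Type) [Field F] [NumberField F] (E : WeierstrassCurve F) [E.IsElliptic], LTailSigma4Sharp F E) ∧
    ¬ ∃ l₀ : ℕ, ∀ l : ℕ, l₀ ≤ l →
      ∀ (F : Type) [Field F] [NumberField F] (E : WeierstrassCurve F) [E.IsElliptic]
        (K Fbar : Type) [Field K] [NumberField K] [Algebra F K] [Field Fbar] [Algebra F Fbar] [Algebra K Fbar]
        (Pb : BadPlacePredicates K) (D : InitialThetaData F K Fbar E l Pb),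
        ∃ rout : ∀ pp : Nat.Primes, (thetaIndex (pilotDataOfK D K)).Fibre (.inr pp) → ℤ,
          (∀ (pp : Nat.Primes) (w : (thetaIndex (pilotDataOfK D K)).Fibre (.inr pp)),
            haveI : Fact (pp : ℕ).Prime := ⟨pp.2⟩
            placeOf (pilotDataOfK D K) pp.1 w ∈ (pilotDataOfK D K).S →
              StrictMinPow pp (ramIdx K (placeOf (pilotDataOfK D K) pp.1 w)) (rout pp w) ∧
              ∃ z ∈ (logUnits (kOf (pilotDataOfK D K) pp.1 w) : Set (kOf (pilotDataOfK D K) pp.1 w)),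
                ((pp : ℕ) : ℝ) ^ (-(rout pp w : ℝ) / (ramIdx K (placeOf (pilotDataOfK D K) pp.1 w) : ℝ)) ≤ ‖z‖) ∧
          ∀ rin : ∀ pp : Nat.Primes, (thetaIndex (pilotDataOfK D K)).Fibre (.inr pp) → ℤ,
            (∀ (pp : Nat.Primes) (w : (thetaIndex (pilotDataOfK D K)).Fibre (.inr pp)),
              haveI : Fact (pp : ℕ).Prime := ⟨pp.2⟩
              placeOf (pilotDataOfK D K) pp.1 w ∈ (pilotDataOfK D K).S → 1 ≤ rin pp w) →
            HStarClosedForm (pilotDataOfK D K) rin rout :=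
  ⟨fun F _ _ E _ => lTailSigma4Sharp_holds F E, not_exists_uniform_l0_hStarClosedForm⟩

end Uniform

end Summit.ABC.IUTFork.Repair.RH.Q3LTailHullSharp

end
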